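import Literature.Geometry.Riemannian.ChangGurskyYangSpectral
import Literature.Geometry.Riemannian.EigenvaluePinchingSphereMoserProofs
import Literature.Geometry.Lorentzian.ConformalChangeRicci
import Literature.Geometry.Lorentzian.TrilinearNormSq
import Literature.Geometry.Riemannian.RicciHessianDivergence
import HarnessLib

/-!
# `σ₂(A)` under a conformal change `g' = e^{2w} g` in dimension four: the pointwise law and the
# reduction of the conformal invariance of `∫σ₂(A) dV` to the integrated contracted Bianchi pairing

Chang–Gursky–Yang 2003, §1, pp. 110–111: with the Weyl–Schouten tensor `A = Ric − (1/6)R g` and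
`σ₂(A) = σ₂(g⁻¹A) = −½|E|² + R²/24`, "the quantity `∫σ₂(A) dvol` is conformally invariant as well"
(p. 111, there deduced from the Chern–Gauss–Bonnet formula (1.1) and the pointwise invariance of
`|W|² dvol`); it is the invariance behind "the conformal invariant `κ`" of (1.12) (p. 114; p. 116:
"`κ` ... is equal to zero") in the proof of Thm. 1.4, and behind `GurskyViaclovskyPath.kappa`.
This file proves,
DIRECTLY from the transformation law of `A` (Chang–Gursky–Yang 2002, (0.4):
`A_{g'} = A − 2∇²w + 2dw ⊗ dw − |dw|² g`; tree: `weylSchouten_conformal_exp_four`), for `C^∞`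
metrics `g` (Riemannian) and `g' = e^{2w} g` on a `4`-manifold modelled on `ℝ⁴`:

* `sigma2_frame_expand` — the algebra of `σ₂` of a perturbed symmetric `4 × 4` array:
  `σ₂(A − 2H + 2b⊗b − |b|²δ) = σ₂(A) + [2⟨Ric,H⟩ − R·trH] + 2[(trH)² − |H|² − Ric(b,b)]
  + 2[trH·|b|² + 2H(b,b)]` for `A = Ric − (R/6)δ` with `trRic = R`;
* `exp_mul_sigma2WeylSchouten_conformal_exp_frame` — **the pointwise law in a `g`-orthonormal
  frame `e`**: `e^{4w}σ₂(A_{g'}) = σ₂(A_g) + [2Σ Ric_{ab}H_{ab} − R ΣH_{aa}] + 2[(ΣH_{aa})² − ΣH_{ab}²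
  − ΣRic_{ab}b_ab_b] + 2[(ΣH_{aa})|dw|² + 2ΣH_{ab}b_ab_b]` with `H = Hess_g w`, `b_a = dw(e_a)`
  (`σ₂` of `g'` read on the `g'`-orthonormal frame `e^{−w}e`,
  `sigma2WeylSchouten_eq_sigma2WeylSchoutenFrame`);
* `exp_mul_sigma2WeylSchouten_conformal_exp` — **the same law intrinsically**:
  `e^{4w}σ₂(A_{g'}) = σ₂(A_g) + [2⟨Ric, Hess w⟩_g − R_g Δ_g w]
  + 2[(Δ_g w)² − |Hess w|²_g − Ric(∇w,∇w)] + 2[Δ_g w |dw|²_g + 2 Hess w(∇w,∇w)]`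
  (`⟨Ric, Hess w⟩_g = innerBilin`, `|·|²_g = normSq`, `∇w = ♯dw`, `|dw|² = g⁻¹(dw,dw) = gradSq`);
* `sigma2WeylSchoutenIntegral_conformal_exp` — **on a closed `4`-manifold,
  `∫σ₂(A_{g'}) dV_{g'} = ∫σ₂(A_g) dV_g + ∫(2⟨Ric, Hess w⟩ − R Δw) dV_g`**: `dV_{g'} = e^{4w}dV_g`,
  the second bracket integrates to zero by the integrated Bochner formula
  (`integral_normSq_hessian_add_integral_ricci_eq`) and the third by Green's identity with
  `d|∇w|² = 2Hess w(·,∇w)` (`integral_mul_dalembertian_eq_neg_integral_innerDual`,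
  `mvfderiv_gradSq_apply`);
* `sigma2WeylSchoutenIntegral_conformal_exp_of_bianchiPairing` — hence **`∫σ₂(A) dV` is a
  conformal invariant as soon as `∫(2⟨Ric, Hess w⟩ − R Δw) dV = 0`**, i.e. `∫⟨Ric − ½Rg, Hess w⟩ dV
  = 0`: the weak (twice integrated by parts) form of the contracted Bianchi identity
  `div(Ric − ½Rg) = 0` (O'Neill 1983, Cor. 3.54), which the tree has in coordinates
  (`MetricCoord.IsMetricOn.fderiv_scalAt`) and, since `RicciHessianDivergence.lean`, on closed
  manifolds (`integral_two_mul_innerBilin_ricci_hessian_sub_eq_zero`);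
* `sigma2WeylSchoutenIntegral_conformal_exp_eq`, `sigma2WeylSchoutenIntegral_eq_of_isConformalTo` —
  **`∫σ₂(A) dV` IS a conformal invariant of closed Riemannian `4`-manifolds** (unconditionally:
  the pairing hypothesis is discharged by the weak contracted Bianchi identity of
  `RicciHessianDivergence.lean`; for the conformal-class form the conformal factor is smooth,
  `contMDiff_conformalFactor_one`, and `w = ½ log φ`).

Everything is proved; no definition and no named fact is introduced; the Chern–Gauss–Bonnet formula is
not used.

## References

* S.-Y. A. Chang, M. J. Gursky, P. C. Yang, *A conformally invariant sphere theorem in four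
  dimensions*, Publ. Math. IHÉS 98 (2003) 105–143, §1, pp. 110–111 ((1.1)), p. 114 ((1.12)),
  p. 116. [ChangGurskyYang2003]
* S.-Y. A. Chang, M. J. Gursky, P. C. Yang, *An equation of Monge–Ampère type in conformal
  geometry…*, Ann. of Math. 155 (2002) 709–787, (0.4). [ChangGurskyYang2002]
* A. L. Besse, *Einstein Manifolds* (1987), Thm. 1.159. [Besse1987]
* B. O'Neill, *Semi-Riemannian geometry* (1983), Ch. 3, pp. 60–61, 86, Cor. 3.54. [ONeill1983]
-/

noncomputable section

open Bundle Finset Module MeasureTheory Set Filter Function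
open scoped Manifold ContDiff Topology ENNReal

namespace Literature.Geometry.Riemannian

open Lorentzian Lorentzian.PseudoRiemannianMetric

/-! ### Linear algebra: the `σ₂` expansion -/

section Algebra

/-- **The algebra of `σ₂` under `A ↦ A − 2H + 2b ⊗ b − |b|² δ` for symmetric `4 × 4` arrays**,
with `A = Ric − (R/6)δ`, `Σ Ric_{aa} = R`, `|b|² = Σ b_a²`:
`½((trÃ)² − ΣÃ_{ab}Ã_{ba}) = ½((trA)² − ΣA_{ab}A_{ba}) + [2ΣRic_{ab}H_{ab} − RΣH_{aa}]
+ 2[(ΣH_{aa})² − ΣH_{ab}² − ΣRic_{ab}b_ab_b] + 2[(ΣH_{aa})|b|² + 2ΣH_{ab}b_ab_b]`. [folklore] -/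
theorem sigma2_frame_expand (Rc Hs : Fin 4 → Fin 4 → ℝ) (bv : Fin 4 → ℝ) (R s : ℝ)
    (hRc : ∀ a b, Rc a b = Rc b a) (hHs : ∀ a b, Hs a b = Hs b a)
    (hs : s = ∑ a, bv a ^ 2) (hR : ∑ a, Rc a a = R) :
    1 / 2 * ((∑ a, (Rc a a - R / 6 * frameDelta a a - 2 * Hs a a + 2 * (bv a * bv a)
        - s * frameDelta a a)) ^ 2 -
      ∑ a, ∑ b, (Rc a b - R / 6 * frameDelta a b - 2 * Hs a b + 2 * (bv a * bv b)
          - s * frameDelta a b) *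
        (Rc b a - R / 6 * frameDelta b a - 2 * Hs b a + 2 * (bv b * bv a)
          - s * frameDelta b a)) =
    1 / 2 * ((∑ a, (Rc a a - R / 6 * frameDelta a a)) ^ 2 -
        ∑ a, ∑ b, (Rc a b - R / 6 * frameDelta a b) * (Rc b a - R / 6 * frameDelta b a))
      + (2 * ∑ a, ∑ b, Rc a b * Hs a b - R * ∑ a, Hs a a)
      + 2 * ((∑ a, Hs a a) ^ 2 - ∑ a, ∑ b, Hs a b ^ 2 - ∑ a, ∑ b, Rc a b * (bv a * bv b))
      + 2 * ((∑ a, Hs a a) * s + 2 * ∑ a, ∑ b, Hs a b * (bv a * bv b)) := by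
  subst hs hR
  simp only [Fin.sum_univ_four, frameDelta, Fin.isValue, if_true, Fin.zero_eq_one_iff,
    Fin.one_eq_zero_iff, OfNat.ofNat_ne_one, if_false, Fin.reduceEq]
  rw [hRc 1 0, hRc 2 0, hRc 3 0, hRc 2 1, hRc 3 1, hRc 3 2,
    hHs 1 0, hHs 2 0, hHs 3 0, hHs 2 1, hHs 3 1, hHs 3 2]
  ring

end Algebra

/-! ### The pointwise law -/

section Pointwise

variable {M : Type*} [TopologicalSpace M] [ChartedSpace (EuclideanSpace ℝ (Fin 4)) M]
  [IsManifold (𝓡 4) ∞ M]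
  (g g' : PseudoRiemannianMetric (𝓡 4) ∞ (EuclideanSpace ℝ (Fin 4)) (TangentSpace (𝓡 4) : M → Type _))
  [g.HasLeviCivita] [g'.HasLeviCivita]

/-- **`σ₂(A)` of `g' = e^{2w} g` in a `g`-orthonormal frame, dimension four.** For `C^∞` metrics
`g` (Riemannian) and `g'` with `g' = e^{2w} g`, `w ∈ C^∞`, at a point `x` with a `g_x`-orthonormal
frame `e`, writing `Ric_{ab} = Ric_g(e_a,e_b)`, `H_{ab} = Hess_g w(e_a,e_b)`, `b_a = dw(e_a)`,
`|dw|² = g⁻¹(dw,dw)`: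
`e^{4w(x)} σ₂(A_{g'})(x) = σ₂(A_g)(x) + [2Σ_{ab}Ric_{ab}H_{ab} − R_g Σ_aH_{aa}]
 + 2[(Σ_aH_{aa})² − Σ_{ab}H_{ab}² − Σ_{ab}Ric_{ab}b_ab_b] + 2[(Σ_aH_{aa})|dw|² + 2Σ_{ab}H_{ab}b_ab_b]`.
Proof: `e' = e^{−w(x)}e` is `g'`-orthonormal, `σ₂(A_{g'}) = ½((ΣA'_{aa})² − ΣA'_{ab}A'_{ba})` on
`e'` (`sigma2WeylSchouten_eq_sigma2WeylSchoutenFrame`), and by the law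
`A' = A − 2Hess w + 2dw⊗dw − |dw|²g` (`weylSchouten_conformal_exp_four`; Chang–Gursky–Yang 2002,
(0.4)) `A'(e'_a,e'_b) = e^{−2w}(A_{ab} − 2H_{ab} + 2b_ab_b − |dw|²δ_{ab})`; the rest is
`sigma2_frame_expand`. [cite: ChangGurskyYang2002, (0.4)] [cite: ChangGurskyYang2003, §1, pp. 110–111] -/
theorem exp_mul_sigma2WeylSchouten_conformal_exp_frame {w : M → ℝ}
    (hw : ContMDiff (𝓡 4) 𝓘(ℝ) ∞ w)
    (hgg' : ∀ (x : M) (v v' : TangentSpace (𝓡 4) x), g'.val x v v' = Real.exp (2 * w x) * g.val x v v')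
    {x : M} {e : Fin 4 → TangentSpace (𝓡 4) x} (he : g.IsOrthonormalFrame x e) :
    Real.exp (4 * w x) * g'.sigma2WeylSchouten x =
      g.sigma2WeylSchouten x
      + (2 * ∑ a, ∑ b, g.ricci x (e a) (e b) * g.hessian w x (e a) (e b)
          - g.scalarCurvature x * ∑ a, g.hessian w x (e a) (e a))
      + 2 * ((∑ a, g.hessian w x (e a) (e a)) ^ 2 - ∑ a, ∑ b, g.hessian w x (e a) (e b) ^ 2
          - ∑ a, ∑ b, g.ricci x (e a) (e b) * (mvfderiv (𝓡 4) w x (e a) * mvfderiv (𝓡 4) w x (e b)))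
      + 2 * ((∑ a, g.hessian w x (e a) (e a)) *
            g.innerDual x (mvfderiv (𝓡 4) w x).toLinearMap (mvfderiv (𝓡 4) w x).toLinearMap
          + 2 * ∑ a, ∑ b, g.hessian w x (e a) (e b) *
              (mvfderiv (𝓡 4) w x (e a) * mvfderiv (𝓡 4) w x (e b))) := by
  classical
  have hE : finrank ℝ (EuclideanSpace ℝ (Fin 4)) = 4 := finrank_euclideanSpace_fin
  have hn2 : (2 : ℕ∞ω) ≤ ((⊤ : ℕ∞) : ℕ∞ω) := WithTop.coe_le_coe.mpr le_top
  have hι : Fintype.card (Fin 4) = finrank ℝ (EuclideanSpace ℝ (Fin 4)) := by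
    rw [Fintype.card_fin, hE]
  -- the rescaled frame `e' = e^{-w(x)} e` is `g'`-orthonormal
  set c : ℝ := Real.exp (-w x) with hc
  have hc2 : c ^ 2 * Real.exp (2 * w x) = 1 := by
    rw [hc, sq, ← Real.exp_add, ← Real.exp_add, show -w x + -w x + 2 * w x = 0 by ring,
      Real.exp_zero]
  have hval' : ∀ v v' : TangentSpace (𝓡 4) x, g.val x v v' = c ^ 2 * g'.val x v v' := by
    intro v v'
    rw [hgg' x v v', ← mul_assoc, hc2, one_mul]
  have he' : g'.IsOrthonormalFrame x (fun i ↦ c • e i) :=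
    IsOrthonormalFrame.smul_of_conformal g' hval' he
  -- abbreviations
  set Rc : Fin 4 → Fin 4 → ℝ := fun a b ↦ g.ricci x (e a) (e b) with hRc
  set Hs : Fin 4 → Fin 4 → ℝ := fun a b ↦ g.hessian w x (e a) (e b) with hHs
  set bv : Fin 4 → ℝ := fun a ↦ mvfderiv (𝓡 4) w x (e a) with hbv
  set R : ℝ := g.scalarCurvature x with hR
  set s : ℝ := g.innerDual x (mvfderiv (𝓡 4) w x).toLinearMap (mvfderiv (𝓡 4) w x).toLinearMap
    with hsdef
  -- symmetry of `Ric` and `Hess w`, `Σ Ric_aa = R`, `|dw|² = Σ b_a²`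
  have hRcs : ∀ a b, Rc a b = Rc b a := fun a b ↦ (g.ricci_symm_holds hn2 x).eq (e a) (e b)
  have hw2 : ContMDiffAt (𝓡 4) 𝓘(ℝ, ℝ) 2 w x := (hw.of_le hn2).contMDiffAt
  have hHss : ∀ a b, Hs a b = Hs b a := fun a b ↦ (g.hessian_symm_holds hw2).eq (e a) (e b)
  have hsum : ∑ a, Rc a a = R := he.sum_ricci_eq_scalarCurvature g hE
  have hO : (g.toBilinForm x).IsOrthoᵢ (he.toBasis hι) := by
    intro i j hij
    rw [he.coe_toBasis hι]
    exact he.2 i j hij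
  have hcne : ∀ i, g.val x (he.toBasis hι i) (he.toBasis hι i) ≠ 0 := fun i ↦ by
    rw [he.coe_toBasis hι, he.1 i]
    exact one_ne_zero
  have hs : s = ∑ a, bv a ^ 2 := by
    rw [hsdef, g.innerDual_eq_sum_of_isOrthoᵢ x (he.toBasis hι) hO hcne]
    refine Finset.sum_congr rfl fun a _ ↦ ?_
    rw [he.coe_toBasis hι, he.1 a, hbv, div_one, sq]
    rfl
  -- the entries of `A'` on `e'`: `c² (A_ab − 2H_ab + 2 b_a b_b − s δ_ab)`
  have hδ : ∀ a b, g.val x (e a) (e b) = frameDelta a b := fun a b ↦ by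
    rw [he.val_eq_ite, frameDelta]
  have hδ' : ∀ a b, g'.val x (c • e a) (c • e b) = frameDelta a b := fun a b ↦ by
    rw [he'.val_eq_ite, frameDelta]
  have hA' : ∀ a b, g'.weylSchoutenFrame x (fun i ↦ c • e i) a b =
      c ^ 2 * (Rc a b - R / 6 * frameDelta a b - 2 * Hs a b + 2 * (bv a * bv b)
        - s * frameDelta a b) := by
    intro a b
    have hlaw := g.weylSchouten_conformal_exp_four g' hE hw hgg' x (c • e a) (c • e b)
    unfold PseudoRiemannianMetric.weylSchoutenFrame
    conv_lhs => rw [← hδ' a b]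
    rw [hlaw]
    simp only [map_smul, LinearMap.smul_apply, FunLike.coe_smul, Pi.smul_apply, smul_eq_mul]
    rw [hδ a b]
    simp only [hRc, hHs, hbv, hR, hsdef]
    ring
  have hA : ∀ a b, g.weylSchoutenFrame x e a b = Rc a b - R / 6 * frameDelta a b := fun a b ↦ rfl
  -- `σ₂'` on `e'` and `σ₂` on `e`
  rw [g'.sigma2WeylSchouten_eq_sigma2WeylSchoutenFrame hn2 hE he',
    g.sigma2WeylSchouten_eq_sigma2WeylSchoutenFrame hn2 hE he]
  have key : g'.sigma2WeylSchoutenFrame x (fun i ↦ c • e i) =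
      c ^ 4 * (1 / 2 * ((∑ a, (Rc a a - R / 6 * frameDelta a a - 2 * Hs a a + 2 * (bv a * bv a)
          - s * frameDelta a a)) ^ 2 -
        ∑ a, ∑ b, (Rc a b - R / 6 * frameDelta a b - 2 * Hs a b + 2 * (bv a * bv b)
            - s * frameDelta a b) *
          (Rc b a - R / 6 * frameDelta b a - 2 * Hs b a + 2 * (bv b * bv a)
            - s * frameDelta b a))) := by
    unfold PseudoRiemannianMetric.sigma2WeylSchoutenFrame
    simp only [hA']
    simp only [Fin.sum_univ_four]
    ring
  have key0 : g.sigma2WeylSchoutenFrame x e =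
      1 / 2 * ((∑ a, (Rc a a - R / 6 * frameDelta a a)) ^ 2 -
        ∑ a, ∑ b, (Rc a b - R / 6 * frameDelta a b) * (Rc b a - R / 6 * frameDelta b a)) := by
    unfold PseudoRiemannianMetric.sigma2WeylSchoutenFrame
    simp only [hA]
  have hc4 : Real.exp (4 * w x) * c ^ 4 = 1 := by
    have h4 : Real.exp (4 * w x) = Real.exp (2 * w x) ^ 2 := by
      rw [sq, ← Real.exp_add]
      congr 1
      ring
    rw [h4]
    calc Real.exp (2 * w x) ^ 2 * c ^ 4 = (c ^ 2 * Real.exp (2 * w x)) ^ 2 := by ring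
      _ = 1 := by rw [hc2, one_pow]
  rw [key, ← mul_assoc, hc4, one_mul, key0,
    sigma2_frame_expand Rc Hs bv R s hRcs hHss hs hsum]

/-- **`σ₂(A)` of `g' = e^{2w} g`, intrinsically, dimension four** (Chang–Gursky–Yang 2002, (0.4);
2003, §1, pp. 110–111): for `C^∞` metrics `g` (Riemannian) and `g' = e^{2w} g`, `w ∈ C^∞`, at every
point
`e^{4w} σ₂(A_{g'}) = σ₂(A_g) + [2⟨Ric_g, Hess_g w⟩_g − R_g Δ_g w]
 + 2[(Δ_g w)² − |Hess_g w|²_g − Ric_g(∇w, ∇w)] + 2[Δ_g w · g⁻¹(dw,dw) + 2 Hess_g w(∇w, ∇w)]`,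
where `⟨Ric, Hess w⟩_g = innerBilin` is the metric pairing of the two symmetric forms
(`TrilinearNormSq.lean`), `|·|²_g = normSq`, `Δ_g = dalembertian`, `∇w = ♯dw`, `g⁻¹(dw,dw) = gradSq w` — the frame law
`exp_mul_sigma2WeylSchouten_conformal_exp_frame` read through the frame dictionary
(`trace_eq_sum_of_isOrthonormalFrame`, `normSq_eq_sum_sq`, `sharp_eq_sum_of_isOrthoᵢ`,
`innerBilin_eq_sum_mul`). [cite: ChangGurskyYang2002, (0.4)] [cite: ChangGurskyYang2003, §1, pp. 110–111] -/
theorem exp_mul_sigma2WeylSchouten_conformal_exp (hg : g.IsRiemannian) {w : M → ℝ}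
    (hw : ContMDiff (𝓡 4) 𝓘(ℝ) ∞ w)
    (hgg' : ∀ (x : M) (v v' : TangentSpace (𝓡 4) x), g'.val x v v' = Real.exp (2 * w x) * g.val x v v')
    (x : M) :
    Real.exp (4 * w x) * g'.sigma2WeylSchouten x =
      g.sigma2WeylSchouten x
      + (2 * g.innerBilin x (g.ricci x) (g.hessian w x)
          - g.scalarCurvature x * g.dalembertian w x)
      + 2 * (g.dalembertian w x ^ 2 - g.normSq x (g.hessian w x)
          - g.ricci x (g.sharp x (mvfderiv (𝓡 4) w x).toLinearMap)
              (g.sharp x (mvfderiv (𝓡 4) w x).toLinearMap))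
      + 2 * (g.dalembertian w x * g.gradSq w x
          + 2 * g.hessian w x (g.sharp x (mvfderiv (𝓡 4) w x).toLinearMap)
              (g.sharp x (mvfderiv (𝓡 4) w x).toLinearMap)) := by
  classical
  have hE : finrank ℝ (EuclideanSpace ℝ (Fin 4)) = 4 := finrank_euclideanSpace_fin
  have hn2 : (2 : ℕ∞ω) ≤ ((⊤ : ℕ∞) : ℕ∞ω) := WithTop.coe_le_coe.mpr le_top
  have hι : Fintype.card (Fin 4) = finrank ℝ (EuclideanSpace ℝ (Fin 4)) := by
    rw [Fintype.card_fin, hE]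
  obtain ⟨e, he⟩ := g.exists_basis_isOrthonormalFrame (x := x) (fun v hv ↦ hg x v hv) hE
  rw [exp_mul_sigma2WeylSchouten_conformal_exp_frame g g' hw hgg' he]
  -- the frame dictionary
  have hO : (g.toBilinForm x).IsOrthoᵢ e := fun i j hij ↦ he.2 i j hij
  have hcne : ∀ i, g.val x (e i) (e i) ≠ 0 := fun i ↦ by
    rw [he.1 i]
    exact one_ne_zero
  set dw := (mvfderiv (𝓡 4) w x).toLinearMap with hdw
  have h1 : ∑ a, g.hessian w x (e a) (e a) = g.dalembertian w x := by
    unfold PseudoRiemannianMetric.dalembertian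
    rw [g.trace_eq_sum_of_isOrthonormalFrame e he]
  have h2 : ∑ a, ∑ b, g.hessian w x (e a) (e b) ^ 2 = g.normSq x (g.hessian w x) := by
    rw [g.normSq_eq_sum_sq x e hO hcne, Finset.sum_comm]
    simp only [he.1, mul_one, div_one]
  have hsharp : g.sharp x dw = ∑ i, dw (e i) • e i := by
    rw [g.sharp_eq_sum_of_isOrthoᵢ x e hO hcne]
    simp only [he.1, div_one]
  have hRsym : ∀ a b, g.ricci x (e a) (e b) = g.ricci x (e b) (e a) := fun a b ↦
    (g.ricci_symm_holds hn2 x).eq (e a) (e b)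
  have hw2 : ContMDiffAt (𝓡 4) 𝓘(ℝ, ℝ) 2 w x := (hw.of_le hn2).contMDiffAt
  have hHsym : ∀ a b, g.hessian w x (e a) (e b) = g.hessian w x (e b) (e a) := fun a b ↦
    (g.hessian_symm_holds hw2).eq (e a) (e b)
  have h3 : g.ricci x (g.sharp x dw) (g.sharp x dw) =
      ∑ a, ∑ b, g.ricci x (e a) (e b) * (dw (e a) * dw (e b)) := by
    rw [hsharp]
    simp only [map_sum, map_smul, LinearMap.sum_apply, LinearMap.smul_apply, smul_eq_mul,
      Finset.mul_sum]
    refine Finset.sum_congr rfl fun a _ ↦ Finset.sum_congr rfl fun b _ ↦ ?_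
    rw [hRsym b a]
    ring
  have h4 : g.hessian w x (g.sharp x dw) (g.sharp x dw) =
      ∑ a, ∑ b, g.hessian w x (e a) (e b) * (dw (e a) * dw (e b)) := by
    rw [hsharp]
    simp only [map_sum, map_smul, LinearMap.sum_apply, LinearMap.smul_apply, smul_eq_mul,
      Finset.mul_sum]
    refine Finset.sum_congr rfl fun a _ ↦ Finset.sum_congr rfl fun b _ ↦ ?_
    rw [hHsym b a]
    ring
  have h5 : g.gradSq w x = g.innerDual x dw dw := rfl
  have h6 : g.innerBilin x (g.ricci x) (g.hessian w x) =
      ∑ a, ∑ b, g.ricci x (e a) (e b) * g.hessian w x (e a) (e b) := by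
    rw [g.innerBilin_eq_sum_mul x e hO hcne, Finset.sum_comm]
    simp only [he.1, mul_one, div_one]
  have hdwe : ∀ a, dw (e a) = mvfderiv (𝓡 4) w x (e a) := fun a ↦ rfl
  simp only [hdwe] at h3 h4
  rw [h1, h2, h6, h5, h3, h4]

end Pointwise

/-! ### The integral identity on a closed four-manifold -/

section Integral

variable {M : Type*} [TopologicalSpace M] [T2Space M] [SecondCountableTopology M] [CompactSpace M]
  [ChartedSpace (EuclideanSpace ℝ (Fin 4)) M] [IsManifold (𝓡 4) ∞ M]
  [MeasurableSpace M] [BorelSpace M]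
  (g g' : PseudoRiemannianMetric (𝓡 4) ∞ (EuclideanSpace ℝ (Fin 4)) (TangentSpace (𝓡 4) : M → Type _))
  [g.HasLeviCivita] [g'.HasLeviCivita]

/-- **`∫σ₂(A) dV` under a conformal change on a closed `4`-manifold, reduced to the Bianchi
pairing.** For `C^∞` Riemannian metrics `g` and `g' = e^{2w} g` (`w ∈ C^∞`) on a closed `4`-manifold,
`∫_M σ₂(A_{g'}) dV_{g'} = ∫_M σ₂(A_g) dV_g + ∫_M (2⟨Ric_g, Hess_g w⟩_g − R_g Δ_g w) dV_g`.
Proof: `dV_{g'} = e^{4w} dV_g` (`riemannianMeasure_of_conformal`) and the pointwise law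
`exp_mul_sigma2WeylSchouten_conformal_exp`; the bracket `(Δw)² − |Hess w|² − Ric(∇w,∇w)`
integrates to zero by the integrated Bochner formula (`integral_normSq_hessian_add_integral_ricci_eq`),
and `Δw·|dw|² + 2Hess w(∇w,∇w) = Δw·|dw|² + g⁻¹(d|dw|², dw)` (`mvfderiv_gradSq_apply`) integrates to
zero by Green's identity (`integral_mul_dalembertian_eq_neg_integral_innerDual`). The remaining
integral `∫⟨2Ric − Rg, Hess w⟩ dV` vanishes by the contracted Bianchi identity `div(Ric − ½Rg) = 0`
integrated by parts (O'Neill 1983, Cor. 3.54), which is NOT proved here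
(see `sigma2WeylSchoutenIntegral_conformal_exp_of_bianchiPairing`). Chang–Gursky–Yang 2003, p. 111:
"the quantity `∫σ₂(A) dvol` is conformally invariant". [cite: ChangGurskyYang2003, §1, pp. 110–111]
[cite: ChangGurskyYang2002, (0.4)] [cite: ONeill1983, Ch. 3, Cor. 3.54] -/
theorem sigma2WeylSchoutenIntegral_conformal_exp (hg : g.IsRiemannian) (hg' : g'.IsRiemannian)
    {w : M → ℝ} (hw : ContMDiff (𝓡 4) 𝓘(ℝ) ∞ w)
    (hgg' : ∀ (x : M) (v v' : TangentSpace (𝓡 4) x), g'.val x v v' = Real.exp (2 * w x) * g.val x v v') :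
    g'.sigma2WeylSchoutenIntegral = g.sigma2WeylSchoutenIntegral +
      ∫ x, (2 * g.innerBilin x (g.ricci x) (g.hessian w x)
            - g.scalarCurvature x * g.dalembertian w x)
        ∂(riemannianMeasure (g.toContMDiffRiemannianMetric hg)) := by
  set G₀ := g.toContMDiffRiemannianMetric hg with hG₀
  set G₀' := g'.toContMDiffRiemannianMetric hg' with hG₀'
  haveI hLC : (ofRiemannian G₀).HasLeviCivita := ‹g.HasLeviCivita›
  haveI hLC' : (ofRiemannian G₀').HasLeviCivita := ‹g'.HasLeviCivita›
  set μ : Measure M := riemannianMeasure G₀ with hμ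
  haveI : IsFiniteMeasure μ := isFiniteMeasure_riemannianMeasure G₀
  have hE : finrank ℝ (EuclideanSpace ℝ (Fin 4)) = 4 := finrank_euclideanSpace_fin
  have hn2 : (2 : ℕ∞ω) ≤ ((⊤ : ℕ∞) : ℕ∞ω) := WithTop.coe_le_coe.mpr le_top
  have hw1 : ContMDiff (𝓡 4) 𝓘(ℝ, ℝ) 1 w := hw.of_le (by exact_mod_cast le_top)
  have hw2 : ContMDiff (𝓡 4) 𝓘(ℝ, ℝ) 2 w := hw.of_le hn2
  -- the four pointwise pieces
  set T : M → ℝ := fun x ↦ 2 * g.innerBilin x (g.ricci x) (g.hessian w x)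
      - g.scalarCurvature x * g.dalembertian w x with hT
  set B : M → ℝ := fun x ↦ g.dalembertian w x ^ 2 - g.normSq x (g.hessian w x)
      - g.ricci x (g.sharp x (mvfderiv (𝓡 4) w x).toLinearMap)
          (g.sharp x (mvfderiv (𝓡 4) w x).toLinearMap) with hB
  set C : M → ℝ := fun x ↦ g.dalembertian w x * g.gradSq w x
      + g.innerDual x (mvfderiv (𝓡 4) (g.gradSq w) x).toLinearMap (mvfderiv (𝓡 4) w x).toLinearMap
    with hC
  have hCx : ∀ x, g.innerDual x (mvfderiv (𝓡 4) (g.gradSq w) x).toLinearMap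
      (mvfderiv (𝓡 4) w x).toLinearMap =
      2 * g.hessian w x (g.sharp x (mvfderiv (𝓡 4) w x).toLinearMap)
        (g.sharp x (mvfderiv (𝓡 4) w x).toLinearMap) := by
    intro x
    rw [PseudoRiemannianMetric.innerDual]
    exact mvfderiv_gradSq_apply g hw x _
  have hpt : ∀ x, Real.exp (4 * w x) * g'.sigma2WeylSchouten x =
      g.sigma2WeylSchouten x + T x + 2 * B x + 2 * C x := by
    intro x
    rw [exp_mul_sigma2WeylSchouten_conformal_exp g g' hg hw hgg' x, hT, hB, hC]
    simp only
    rw [hCx x]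
  -- continuity / integrability of the pieces
  have hσc : Continuous g.sigma2WeylSchouten := g.continuous_sigma2WeylSchouten hg hE
  have hσc' : Continuous g'.sigma2WeylSchouten := g'.continuous_sigma2WeylSchouten hg' hE
  have hexpc : Continuous fun x ↦ Real.exp (4 * w x) :=
    Real.continuous_exp.comp (continuous_const.mul hw.continuous)
  have hΔc : Continuous (g.dalembertian w) := continuous_dalembertian g hw2
  have hNc : Continuous fun x ↦ g.normSq x (g.hessian w x) := (contMDiff_normSq_hessian g hw).continuous
  have hQc : Continuous (g.gradSq w) := (contMDiff_gradSq g hw).continuous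
  have hQ1 : ContMDiff (𝓡 4) 𝓘(ℝ, ℝ) 1 (g.gradSq w) :=
    (contMDiff_gradSq g hw).of_le (by exact_mod_cast le_top)
  have hIc : Continuous fun x ↦ g.innerDual x (mvfderiv (𝓡 4) (g.gradSq w) x).toLinearMap
      (mvfderiv (𝓡 4) w x).toLinearMap := continuous_innerDual_mvfderiv g hQ1 hw1
  obtain ⟨hNi, hRi, hBochner⟩ := integral_normSq_hessian_add_integral_ricci_eq G₀ hw
  have hRi' : Integrable (fun x ↦ g.ricci x (g.sharp x (mvfderiv (𝓡 4) w x).toLinearMap)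
      (g.sharp x (mvfderiv (𝓡 4) w x).toLinearMap)) μ := hRi
  have hLHSi : Integrable (fun x ↦ Real.exp (4 * w x) * g'.sigma2WeylSchouten x) μ :=
    integrable_of_continuous G₀ (hexpc.mul hσc')
  have hσi : Integrable (fun x ↦ g.sigma2WeylSchouten x) μ := integrable_of_continuous G₀ hσc
  have hΔ2i : Integrable (fun x ↦ g.dalembertian w x ^ 2) μ := integrable_of_continuous G₀ (hΔc.pow 2)
  have hNi' : Integrable (fun x ↦ g.normSq x (g.hessian w x)) μ := integrable_of_continuous G₀ hNc
  have hΔNi : Integrable (fun x ↦ g.dalembertian w x ^ 2 - g.normSq x (g.hessian w x)) μ :=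
    hΔ2i.sub hNi'
  have hBi : Integrable (fun x ↦ B x) μ := hΔNi.sub hRi'
  have hC1i : Integrable (fun x ↦ g.dalembertian w x * g.gradSq w x) μ :=
    integrable_of_continuous G₀ (hΔc.mul hQc)
  have hC2i : Integrable (fun x ↦ g.innerDual x (mvfderiv (𝓡 4) (g.gradSq w) x).toLinearMap
      (mvfderiv (𝓡 4) w x).toLinearMap) μ := integrable_of_continuous G₀ hIc
  have hCi : Integrable (fun x ↦ C x) μ := hC1i.add hC2i
  have hTi : Integrable (fun x ↦ T x) μ := by
    have h : (fun x ↦ T x) = fun x ↦ Real.exp (4 * w x) * g'.sigma2WeylSchouten x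
        - g.sigma2WeylSchouten x - 2 * B x - 2 * C x := by
      funext x
      rw [hpt x]
      ring
    rw [h]
    exact ((hLHSi.sub hσi).sub (hBi.const_mul 2)).sub (hCi.const_mul 2)
  have h2Bi : Integrable (fun x ↦ 2 * B x) μ := hBi.const_mul 2
  have h2Ci : Integrable (fun x ↦ 2 * C x) μ := hCi.const_mul 2
  have hσTi : Integrable (fun x ↦ g.sigma2WeylSchouten x + T x) μ := hσi.add hTi
  have hσTBi : Integrable (fun x ↦ g.sigma2WeylSchouten x + T x + 2 * B x) μ := hσTi.add h2Bi
  -- `∫ B = 0` (integrated Bochner) and `∫ C = 0` (Green)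
  have hB0 : ∫ x, B x ∂μ = 0 := by
    have h1 : ∫ x, B x ∂μ = ∫ x, g.dalembertian w x ^ 2 ∂μ
        - ∫ x, g.normSq x (g.hessian w x) ∂μ
        - ∫ x, g.ricci x (g.sharp x (mvfderiv (𝓡 4) w x).toLinearMap)
            (g.sharp x (mvfderiv (𝓡 4) w x).toLinearMap) ∂μ := by
      rw [← integral_sub hΔ2i hNi', ← integral_sub hΔNi hRi']
    rw [h1]
    have h2 : ∫ x, g.normSq x (g.hessian w x) ∂μ
        + ∫ x, g.ricci x (g.sharp x (mvfderiv (𝓡 4) w x).toLinearMap)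
            (g.sharp x (mvfderiv (𝓡 4) w x).toLinearMap) ∂μ
        = ∫ x, g.dalembertian w x ^ 2 ∂μ := hBochner
    linarith
  have hC0 : ∫ x, C x ∂μ = 0 := by
    have hGreen : ∫ x, g.gradSq w x * g.dalembertian w x ∂μ =
        -∫ x, g.innerDual x (mvfderiv (𝓡 4) (g.gradSq w) x).toLinearMap
          (mvfderiv (𝓡 4) w x).toLinearMap ∂μ :=
      integral_mul_dalembertian_eq_neg_integral_innerDual G₀ (u := g.gradSq w) (f := w) hQ1 hw2
    have h3 : ∫ x, C x ∂μ = ∫ x, g.dalembertian w x * g.gradSq w x ∂μ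
        + ∫ x, g.innerDual x (mvfderiv (𝓡 4) (g.gradSq w) x).toLinearMap
            (mvfderiv (𝓡 4) w x).toLinearMap ∂μ := by
      rw [← integral_add hC1i hC2i]
    have h4 : ∫ x, g.dalembertian w x * g.gradSq w x ∂μ = ∫ x, g.gradSq w x * g.dalembertian w x ∂μ :=
      integral_congr_ae (Eventually.of_forall fun x ↦ mul_comm _ _)
    rw [h3, h4, hGreen]
    ring
  -- the volume law `dV_{g'} = e^{4w} dV_g`
  have hvol : riemannianMeasure G₀' = μ.withDensity fun x ↦ ENNReal.ofReal (Real.exp (4 * w x)) := by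
    have h1 := riemannianMeasure_of_conformal G₀' G₀ (φ := fun x ↦ Real.exp (2 * w x))
      (fun x v v' ↦ hgg' x v v')
    rw [h1]
    congr 1
    funext x
    congr 1
    have h4 : Real.exp (4 * w x) = Real.exp (2 * w x) ^ 2 := by
      rw [sq, ← Real.exp_add]
      congr 1
      ring
    rw [show Real.exp (2 * w x) ^ 4 = (Real.exp (4 * w x)) ^ 2 by rw [h4]; ring,
      Real.sqrt_sq (Real.exp_pos _).le]
  have hdens_meas : Measurable fun x ↦ ENNReal.ofReal (Real.exp (4 * w x)) :=
    ENNReal.measurable_ofReal.comp hexpc.measurable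
  have hdens_lt : ∀ᵐ x ∂μ, ENNReal.ofReal (Real.exp (4 * w x)) < ⊤ :=
    ae_of_all _ fun _ ↦ ENNReal.ofReal_lt_top
  have hI' : g'.sigma2WeylSchoutenIntegral = ∫ x, Real.exp (4 * w x) * g'.sigma2WeylSchouten x ∂μ := by
    rw [g'.sigma2WeylSchoutenIntegral_eq hg', ← hG₀', hvol,
      integral_withDensity_eq_integral_toReal_smul hdens_meas hdens_lt]
    refine integral_congr_ae (Eventually.of_forall fun x ↦ ?_)
    simp only [ENNReal.toReal_ofReal (Real.exp_pos _).le, smul_eq_mul]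
  -- assembly
  rw [hI', g.sigma2WeylSchoutenIntegral_eq hg]
  simp_rw [hpt]
  rw [integral_add hσTBi h2Ci, integral_add hσTi h2Bi, integral_add hσi hTi,
    integral_const_mul, integral_const_mul, hB0, hC0]
  simp only [mul_zero, add_zero]
  rfl

/-- **`∫σ₂(A) dV` is a conformal invariant of closed `4`-manifolds, given the weak contracted Bianchi
identity** `∫(2⟨Ric_g, Hess_g w⟩_g − R_g Δ_g w) dV_g = 0`, i.e. `∫⟨Ric − ½Rg, Hess w⟩ dV = 0` (the
Einstein tensor is divergence free, `div(Ric − ½Rg) = 0`, O'Neill 1983, Cor. 3.54, integrated by parts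
twice on the closed manifold): then `∫σ₂(A_{e^{2w}g}) dV_{e^{2w}g} = ∫σ₂(A_g) dV_g` —
Chang–Gursky–Yang 2003, p. 111, "the quantity `∫σ₂(A) dvol` is conformally invariant", here WITHOUT
the Chern–Gauss–Bonnet formula. [cite: ChangGurskyYang2003, §1, pp. 110–111]
[cite: ONeill1983, Ch. 3, Cor. 3.54] -/
theorem sigma2WeylSchoutenIntegral_conformal_exp_of_bianchiPairing (hg : g.IsRiemannian)
    (hg' : g'.IsRiemannian) {w : M → ℝ} (hw : ContMDiff (𝓡 4) 𝓘(ℝ) ∞ w)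
    (hgg' : ∀ (x : M) (v v' : TangentSpace (𝓡 4) x), g'.val x v v' = Real.exp (2 * w x) * g.val x v v')
    (hBianchi : ∫ x, (2 * g.innerBilin x (g.ricci x) (g.hessian w x)
        - g.scalarCurvature x * g.dalembertian w x)
          ∂(riemannianMeasure (g.toContMDiffRiemannianMetric hg)) = 0) :
    g'.sigma2WeylSchoutenIntegral = g.sigma2WeylSchoutenIntegral := by
  rw [sigma2WeylSchoutenIntegral_conformal_exp g g' hg hg' hw hgg', hBianchi, add_zero]

/-- **`∫σ₂(A) dV` is a conformal invariant of closed Riemannian `4`-manifolds** (Chang–Gursky–Yang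
2003, p. 111: "the quantity `∫σ₂(A) dvol` is conformally invariant as well"): for `C^∞` Riemannian
metrics `g` and `g' = e^{2w} g` (`w ∈ C^∞`) on a closed `4`-manifold,
`∫_M σ₂(A_{g'}) dV_{g'} = ∫_M σ₂(A_g) dV_g`. Proof: `sigma2WeylSchoutenIntegral_conformal_exp_of_bianchiPairing`
with the weak contracted Bianchi identity `∫(2⟨Ric, Hess w⟩ − RΔw) dV = 0`
(`integral_two_mul_innerBilin_ricci_hessian_sub_eq_zero`, `RicciHessianDivergence.lean`) — a direct
proof from the transformation law of `A`, NOT through the Chern–Gauss–Bonnet formula (1.1) used in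
the source. [cite: ChangGurskyYang2003, §1, pp. 110–111] [cite: ONeill1983, Ch. 3, Cor. 3.54] -/
theorem sigma2WeylSchoutenIntegral_conformal_exp_eq (hg : g.IsRiemannian) (hg' : g'.IsRiemannian)
    {w : M → ℝ} (hw : ContMDiff (𝓡 4) 𝓘(ℝ) ∞ w)
    (hgg' : ∀ (x : M) (v v' : TangentSpace (𝓡 4) x), g'.val x v v' = Real.exp (2 * w x) * g.val x v v') :
    g'.sigma2WeylSchoutenIntegral = g.sigma2WeylSchoutenIntegral := by
  haveI : (ofRiemannian (g.toContMDiffRiemannianMetric hg)).HasLeviCivita := ‹g.HasLeviCivita›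
  exact sigma2WeylSchoutenIntegral_conformal_exp_of_bianchiPairing g g' hg hg' hw hgg'
    (integral_two_mul_innerBilin_ricci_hessian_sub_eq_zero (g.toContMDiffRiemannianMetric hg) hw)

/-- **`∫σ₂(A) dV` depends only on the conformal class** (Chang–Gursky–Yang 2003, p. 111): for `C^∞`
Riemannian metrics `g`, `g'` on a closed `4`-manifold with `g' ∈ [g]` (`IsConformalTo`),
`∫σ₂(A_{g'}) dV_{g'} = ∫σ₂(A_g) dV_g` — the conformal factor `φ` is smooth
(`contMDiff_conformalFactor_one`) and `g' = e^{2w} g` with `w = ½ log φ`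
(`sigma2WeylSchoutenIntegral_conformal_exp_eq`). [cite: ChangGurskyYang2003, §1, pp. 110–111] -/
theorem sigma2WeylSchoutenIntegral_eq_of_isConformalTo (hg : g.IsRiemannian) (hg' : g'.IsRiemannian)
    (hconf : IsConformalTo (g'.toContMDiffRiemannianMetric hg') (g.toContMDiffRiemannianMetric hg)) :
    g'.sigma2WeylSchoutenIntegral = g.sigma2WeylSchoutenIntegral := by
  obtain ⟨φ, hφ⟩ := hconf
  have hφpos : ∀ x, 0 < φ x := fun x ↦ (hφ x).1
  have hconf' : ∀ (x : M) (v v' : TangentSpace (𝓡 4) x), g'.val x v v' = φ x * g.val x v v' :=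
    fun x v v' ↦ (hφ x).2 v v'
  have hφs : ContMDiff (𝓡 4) 𝓘(ℝ, ℝ) ∞ φ := contMDiff_conformalFactor_one g g' hg hconf'
  set w : M → ℝ := fun x ↦ Real.log (φ x) / 2 with hw
  have hws : ContMDiff (𝓡 4) 𝓘(ℝ) ∞ w := fun x ↦
    ((Real.contDiffAt_log.mpr (hφpos x).ne').comp_contMDiffAt (hφs x)).div_const 2
  have hgg' : ∀ (x : M) (v v' : TangentSpace (𝓡 4) x),
      g'.val x v v' = Real.exp (2 * w x) * g.val x v v' := by
    intro x v v'
    rw [hconf' x v v', hw]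
    congr 1
    rw [show 2 * (Real.log (φ x) / 2) = Real.log (φ x) by ring, Real.exp_log (hφpos x)]
  exact sigma2WeylSchoutenIntegral_conformal_exp_eq g g' hg hg' hws hgg'

end Integral

end Literature.Geometry.Riemannian

end
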